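import Summits.Ventures.QEC.Census.BB.BB144.BZAut4DataZ1
import Summits.Ventures.QEC.Census.BB.BB144.BZData
import Summits.Ventures.QEC.Census.BB.BB144.Cert
import HarnessLib

/-!
# `BB144` — `bz` certificate data (CERT-FORMAT v1 §3 `k_cert` + `logicals` + §5.3 `params`), emitted by qec-search-7

The `BZData` literal of `Census/CertCheckBZ.lean` for the certificate `27af9174ef991c5e` (kernel A, method `bz_aut`, FOUR translation-orbit-cover blocks, qec-search-10): the two
rank certificates (type-02's `RankCert`), the paired logical bases `LX`, `LZ` (12 words each), and the sides'
blocks (in the part files `BZData<S><k>.lean`). DATA only; every literal is re-checked by the Lean words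
(`bzZStruct`, `bzZBlock`, …). Source: HOME/cert/search-10/bb144-bzaut4/BB144.bzaut4.certA.json (qec-search-10, VERIFIED by qec-search-1 verify_cert.py, kit j261881); emitter HOME/census/search-7/emit_bz.py (identifier prefix BZAut4/bzAut4 by qec-search-10).
-/

namespace Summit.Ventures.QEC.Census.BB144



/-- The `bz_aut` data of `BB144`: rank certificates, logical bases (words over the 144 qubits), sides (rank certificates and logical bases = those of `bzData`, the same certificate family; automorphisms and the cover witness table are in `BZAut4Cover<S>.lean`). -/
def bzAut4Data : BZData where
  rcX := rcX
  rcZ := rcZ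
  LX := bzData.LX
  LZ := bzData.LZ
  sideZ := { evenWitness := some [1, 2, 6, 7, 8, 10, 12, 14, 16, 17, 18, 19, 21, 23, 26, 27, 30, 31, 37, 38, 42, 43, 44, 46, 48, 50, 52, 53, 54, 55, 57, 59, 62, 63, 66, 67],
             blocks := [bzAut4BlockZ0, bzAut4BlockZ1, bzAut4BlockZ2, bzAut4BlockZ3] }
  sideX := { evenWitness := none, blocks := [] }

end Summit.Ventures.QEC.Census.BB144
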